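import Summits.ResolutionOfSingularities.KangarooAtlas.MizutaniFrobTensor
import Mathlib.RingTheory.MvPolynomial.Basic
import HarnessLib

/-!
# Mizutani's conjecture — the Hironaka/Mizutani MULTIPLICITY side of the invariant additive forms

Cell topic `Summits/ResolutionOfSingularities/KangarooAtlas` (pub-rosobs); namespace
`Summit.ResolutionOfSingularities.KangarooAtlas.Mizutani`.  Companion to the Lean transcription of the
in-house note MIZUTANI-PROOF-g59 (AI-written, AI-audited; *AI review is weaker than expert review*; not a
resolution theorem).  The chain `mizutaniConjecture` (`MizutaniConjectureHolds.lean`) is stated with Oda's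
PRINTED description of the invariant additive forms `(L_B)_e` of a Hironaka subgroup scheme by differential
operators on coefficients (`invForms`, `Literature/…/HironakaGroupScheme.lean`, Oda 1983-II p. 1168) taken as
the definition.  Hironaka's ORIGINAL definition (Ann. of Math. 92 (1970); Mizutani 1973 Def. 1.1) goes through
MULTIPLICITIES: `U_m(𝔭) = {f ∈ S_m : mult_𝔭 (Proj S/fS) ≥ m}`, `B(𝔭) = Spec(S/U_+(𝔭)S)`, and Mizutani §1 (c)
defines the exponent of `B(𝔭)` as the exponent of the graded `k[F]`-module `U(𝔭) ∩ L`.  Since `ℙ^n` is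
smooth, `mult_𝔭 f ≥ m` says that `f` lies in the `m`-th SYMBOLIC power `𝔭^{(m)} = 𝔭^m S_𝔭 ∩ S`, i.e.
`s f ∈ 𝔭^m` for some `s ∉ 𝔭`.  This file puts that side next to Oda's:

* `coeffOp R σ D` — a differential operator `D` of the coefficient ring acting coefficientwise on
  polynomials; `isDiffOpLE_coeffOp`: the order does not go up (Grothendieck's recursive definition,
  `IsDiffOpLE`); `coeffOp_mul_of_coeff_mem`: linearity over polynomials with coefficients in the base.
* **`coeffOp_mem_of_mul_mem_pow`** — for a prime `𝔭 ⊂ k[X]`, `q = p^e`, `D ∈ Diff_{q−1}(k/k^q)` and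
  `g ∈ 𝔭^{(q)}`: `D g ∈ 𝔭` (operators of order `< q` lower the `𝔭`-adic order by `< q`, applied to
  `s^q g ∈ 𝔭^q`, the coefficients of `s^q` being `q`-th powers).
* `hirForms k p 𝔭 e` — the coefficient vectors of the additive forms of degree `p^e` in Hironaka's algebra
  `U(𝔭)`, i.e. `U(𝔭) ∩ L_e` (Mizutani §1 (c)), transcribed through the symbolic power; it is a `k`-subspace,
  `F`-stable (`frobVec_one_mem_hirForms`), and at level `0` it is `{a : Σ a_j X_j ∈ 𝔭} = invForms k p 𝔭 0`
  (`hirForms_zero`, `invForms_zero`).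
* **`hirForms_le_invForms`** — `U(𝔭) ∩ L_e ⊆ (L_B)_e` for EVERY prime `𝔭`: an additive form with multiplicity
  `p^e` at `𝔭` is an invariant additive form in Oda's sense.  The converse inclusion is Oda's theorem
  (Oda 1973 Prop. 2.2 (ii), "by the Jacobian criterion", quoted on p. 1168 of Oda 1983-II) and is NOT
  proved here (the companion file `MizutaniMultiplicityBridge.lean` records what follows for Mizutani's
  conjecture read through `U(𝔭) ∩ L` under that equality as a displayed hypothesis).

References: [Mizutani1973HironakaGroupSchemes] §1 (Def. 1.1, (a)–(c), Thm. 1.3);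
[Oda1983HironakaGroupSchemeII] §2 (p. 1168); [EGAIV4] §16.8 (differential operators).
-/

open MvPolynomial Literature.AlgebraicGeometry.Resolution
  Literature.AlgebraicGeometry.Resolution.HironakaScheme

namespace Summit.ResolutionOfSingularities.KangarooAtlas.Mizutani

universe u

/-! ## Coefficientwise differential operators -/

section CoeffOp

variable (R : Type*) [CommSemiring R] {A : Type*} [CommRing A] [Algebra R A] (σ : Type*)

/-- A linear endomorphism `D` of the coefficient ring acting COEFFICIENTWISE on polynomials:
`coeffOp D (Σ c_α X^α) = Σ D(c_α) X^α` (Oda: differential operators of `k` "acting on the coefficients").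
[cite: Oda1983HironakaGroupSchemeII, §2 (p. 1168: Diff_{p^e−1}(k/F^e(k)) acting on the coefficients of elements of L_e)] -/
noncomputable def coeffOp (D : A →ₗ[R] A) : MvPolynomial σ A →ₗ[R] MvPolynomial σ A :=
  (AddMonoidAlgebra.coeffLinearEquiv R : MvPolynomial σ A ≃ₗ[R] (σ →₀ ℕ) →₀ A).symm.toLinearMap ∘ₗ
    Finsupp.mapRange.linearMap D ∘ₗ
      (AddMonoidAlgebra.coeffLinearEquiv R : MvPolynomial σ A ≃ₗ[R] (σ →₀ ℕ) →₀ A).toLinearMap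

variable {R σ}

/-- Coefficients of `coeffOp D f`. [folklore] -/
@[simp] theorem coeff_coeffOp (D : A →ₗ[R] A) (f : MvPolynomial σ A) (m : σ →₀ ℕ) :
    coeff m (coeffOp R σ D f) = D (coeff m f) :=
  rfl

/-- `coeffOp` on a monomial. [folklore] -/
theorem coeffOp_monomial (D : A →ₗ[R] A) (m : σ →₀ ℕ) (a : A) :
    coeffOp R σ D (monomial m a) = monomial m (D a) := by
  classical
  ext m'
  simp only [coeff_coeffOp, coeff_monomial]
  split_ifs
  · rfl
  · exact D.map_zero

/-- `coeffOp` is additive in the operator. [folklore] -/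
theorem coeffOp_sub (D E : A →ₗ[R] A) : coeffOp R σ (D - E) = coeffOp R σ D - coeffOp R σ E := by
  refine LinearMap.ext fun f => MvPolynomial.ext _ _ fun m => ?_
  rw [LinearMap.sub_apply, coeff_sub, coeff_coeffOp, coeff_coeffOp, coeff_coeffOp, LinearMap.sub_apply]

/-- `coeffOp 0 = 0`. [folklore] -/
theorem coeffOp_zero : coeffOp R σ (0 : A →ₗ[R] A) = 0 := by
  refine LinearMap.ext fun f => MvPolynomial.ext _ _ fun m => ?_
  rw [coeff_coeffOp, LinearMap.zero_apply, LinearMap.zero_apply, coeff_zero]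

/-- `coeffOp D (C c · f) = coeffOp (D ∘ (c ·)) f`. [folklore] -/
theorem coeffOp_C_mul (D : A →ₗ[R] A) (c : A) (f : MvPolynomial σ A) :
    coeffOp R σ D (C c * f) = coeffOp R σ (D ∘ₗ LinearMap.mulLeft R c) f := by
  ext m
  simp only [coeff_coeffOp, coeff_C_mul, LinearMap.comp_apply, LinearMap.mulLeft_apply]

/-- `C c · coeffOp D f = coeffOp ((c ·) ∘ D) f`. [folklore] -/
theorem C_mul_coeffOp (D : A →ₗ[R] A) (c : A) (f : MvPolynomial σ A) :
    C c * coeffOp R σ D f = coeffOp R σ (LinearMap.mulLeft R c ∘ₗ D) f := by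
  ext m
  simp only [coeff_coeffOp, coeff_C_mul, LinearMap.comp_apply, LinearMap.mulLeft_apply]

/-- **Linearity over polynomials with coefficients in the base**: if every coefficient of `g` comes from
`R`, then `coeffOp D (g f) = g · coeffOp D f`. [folklore] -/
theorem coeffOp_mul_of_coeff_mem (D : A →ₗ[R] A) {g : MvPolynomial σ A}
    (hg : ∀ m, coeff m g ∈ Set.range (algebraMap R A)) (f : MvPolynomial σ A) :
    coeffOp R σ D (g * f) = g * coeffOp R σ D f := by
  classical
  ext m
  rw [coeff_coeffOp, coeff_mul, coeff_mul, map_sum]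
  refine Finset.sum_congr rfl fun x _ => ?_
  obtain ⟨r, hr⟩ := hg x.1
  rw [coeff_coeffOp, ← hr, ← Algebra.smul_def, ← Algebra.smul_def, map_smul]

/-- `[D, Σ a_i] = Σ [D, a_i]` (the commutator is additive in the multiplier). [folklore] -/
theorem commMul_sum_right {ι : Type*} (D : A →ₗ[R] A) (s : Finset ι) (a : ι → A) :
    commMul R D (∑ i ∈ s, a i) = ∑ i ∈ s, commMul R D (a i) := by
  ext t
  simp only [commMul_apply, LinearMap.coe_sum, Finset.sum_apply, Finset.sum_mul, map_sum,
    Finset.sum_sub_distrib]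

/-- The commutator of `coeffOp D` with a monomial `c X^m` is `X^m · coeffOp [D, c]`. [folklore] -/
theorem commMul_coeffOp_monomial (D : A →ₗ[R] A) (m : σ →₀ ℕ) (c : A) :
    commMul R (coeffOp R σ D) (monomial m c) = (monomial m (1 : A)) • coeffOp R σ (commMul R D c) := by
  classical
  have hmon : ∀ m', coeff m' (monomial m (1 : A) : MvPolynomial σ A) ∈ Set.range (algebraMap R A) := by
    intro m'
    rw [coeff_monomial]
    split_ifs
    · exact ⟨1, map_one _⟩
    · exact ⟨0, map_zero _⟩
  have hsplit : (monomial m c : MvPolynomial σ A) = monomial m 1 * C c := by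
    rw [mul_comm, C_mul_monomial, mul_one]
  refine LinearMap.ext fun f => ?_
  rw [commMul_apply, LinearMap.smul_apply, smul_eq_mul, hsplit, mul_assoc, mul_assoc,
    coeffOp_mul_of_coeff_mem D hmon, coeffOp_C_mul, C_mul_coeffOp, ← mul_sub, ← LinearMap.sub_apply,
    ← coeffOp_sub]
  rfl

/-- **Coefficientwise action does not raise the order**: if `D` is a differential operator of order
`≤ n` of `A` over `R`, then `coeffOp D` is a differential operator of order `≤ n` of `A[X_σ]` over `R`
(the commutator with `Σ c_α X^α` is `Σ X^α · coeffOp [D, c_α]`; induction on `n`).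
[cite: EGAIV4, Prop. 16.8.8 (b) (recursive criterion) with 16.4.14 (base change of principal parts)] -/
theorem isDiffOpLE_coeffOp : ∀ (n : ℕ) {D : A →ₗ[R] A}, IsDiffOpLE R n D → IsDiffOpLE R n (coeffOp R σ D)
  | 0, D, hD => by
    intro g
    rw [as_sum g, commMul_sum_right]
    refine Finset.sum_eq_zero fun m _ => ?_
    rw [commMul_coeffOp_monomial, hD (coeff m g), coeffOp_zero, smul_zero]
  | n + 1, D, hD => by
    intro g
    rw [as_sum g, commMul_sum_right]
    refine IsDiffOpLE.sum _ fun m _ => ?_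
    rw [commMul_coeffOp_monomial]
    exact IsDiffOpLE.smul _ (isDiffOpLE_coeffOp n (hD (coeff m g)))

end CoeffOp

/-! ## Over a field of characteristic `p`: coefficients of `q`-th powers, symbolic powers -/

section Field

variable {k : Type u} [Field k] {p : ℕ} [Fact p.Prime] [CharP k p] {σ : Type*}

/-- Every coefficient of `f^{p^e}` is a `p^e`-th power: `(Σ c_α X^α)^{p^e} = Σ c_α^{p^e} X^{p^e α}`.
[cite: Oda1983HironakaGroupSchemeII, §1 (p. 1164: F the p-th power Frobenius; F^e(k) the subfield of p^e-th powers)] -/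
theorem coeff_pow_mem_frobPow (e : ℕ) (f : MvPolynomial σ k) (m : σ →₀ ℕ) :
    coeff m (f ^ p ^ e) ∈ frobPow k p e := by
  classical
  induction f using MvPolynomial.induction_on generalizing m with
  | C a =>
    rw [← C_pow, coeff_C]
    split_ifs
    · exact pow_mem_frobPow e a
    · exact zero_mem _
  | add f g hf hg =>
    rw [add_pow_char_pow, coeff_add]
    exact add_mem (hf m) (hg m)
  | mul_X f i hf =>
    rw [mul_pow, X_pow_eq_monomial, coeff_mul_monomial']
    split_ifs
    · rw [mul_one]; exact hf _
    · exact zero_mem _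

/-- **Differential operators of order `< q` on coefficients map `𝔭^{(q)}` into `𝔭`**: for a prime
`𝔭 ⊂ k[X_σ]`, `q = p^e`, `D ∈ Diff_{q−1}(k/k^q)` acting coefficientwise, and `g` in the symbolic power
`𝔭^{(q)}` (`s g ∈ 𝔭^q` for some `s ∉ 𝔭`): `D g ∈ 𝔭`.  Proof: `s^q g ∈ 𝔭^q`, the coefficients of `s^q` are
`q`-th powers so `D(s^q g) = s^q D g`, and an operator of order `≤ q − 1` maps `𝔭^q` into `𝔭`
(`IsDiffOpLE.apply_mem_pow_sub`); cancel `s^q ∉ 𝔭`.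
[cite: Oda1983HironakaGroupSchemeII, §2 (p. 1168: "(L_B)_e = {h ∈ L_e ; Dh ∈ 𝔭 ∩ L_e for all D ∈ Diff_{p^e−1}(k/F^e(k))}", via the Jacobian criterion)] -/
theorem coeffOp_mem_of_mul_mem_pow (e : ℕ) {𝔭 : Ideal (MvPolynomial σ k)} (h𝔭 : 𝔭.IsPrime)
    {D : k →ₗ[frobPow k p e] k} (hD : IsDiffOpLE (frobPow k p e) (p ^ e - 1) D)
    {g : MvPolynomial σ k} (hg : ∃ s ∉ 𝔭, s * g ∈ 𝔭 ^ p ^ e) :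
    coeffOp (frobPow k p e) σ D g ∈ 𝔭 := by
  obtain ⟨s, hs, hsg⟩ := hg
  have hq : 1 ≤ p ^ e := Nat.one_le_pow _ _ (Fact.out : p.Prime).pos
  have h1 : s ^ p ^ e * g ∈ 𝔭 ^ p ^ e := by
    have : s ^ p ^ e * g = s ^ (p ^ e - 1) * (s * g) := by
      rw [← mul_assoc, ← pow_succ, Nat.sub_add_cancel hq]
    rw [this]
    exact Ideal.mul_mem_left _ _ hsg
  have hcoef : ∀ m, coeff m (s ^ p ^ e) ∈ Set.range (algebraMap (frobPow k p e) k) := fun m =>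
    ⟨⟨_, coeff_pow_mem_frobPow e s m⟩, rfl⟩
  have h2 := IsDiffOpLE.apply_mem_pow_sub 𝔭 (p ^ e) (isDiffOpLE_coeffOp (σ := σ) (p ^ e - 1) hD) h1
  rw [Nat.sub_sub_self hq, pow_one, coeffOp_mul_of_coeff_mem D hcoef] at h2
  exact (h𝔭.mem_or_mem h2).resolve_left fun h => hs (h𝔭.mem_of_pow_mem _ h)

end Field

/-! ## Hironaka's `U(𝔭) ∩ L_e` on coefficient vectors -/

section HirForms

variable (k : Type u) [Field k] (p : ℕ) [Fact p.Prime] [CharP k p] {n : ℕ}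

/-- `coeffOp D` applied to an additive form acts on its coefficient vector. [folklore] -/
theorem coeffOp_addForm (e : ℕ) (D : k →ₗ[frobPow k p e] k) (a : Fin (n + 1) → k) :
    coeffOp (frobPow k p e) (Fin (n + 1)) D (addForm k p e a) = addForm k p e (fun j => D (a j)) := by
  unfold addForm
  rw [map_sum]
  refine Finset.sum_congr rfl fun j _ => ?_
  rw [C_mul_X_pow_eq_monomial, C_mul_X_pow_eq_monomial, coeffOp_monomial]

omit [Fact p.Prime] [CharP k p] in
/-- `addForm (c • a) = C c · addForm a`. [folklore] -/
theorem addForm_smul (e : ℕ) (c : k) (a : Fin (n + 1) → k) :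
    addForm k p e (c • a) = C c * addForm k p e a := by
  simp only [addForm, Pi.smul_apply, smul_eq_mul, map_mul, Finset.mul_sum, mul_assoc]

/-- `addForm (e+1) (F a) = (addForm e a)^p`: `Σ a_j^p X_j^{p^{e+1}} = (Σ a_j X_j^{p^e})^p`.
[cite: Oda1983HironakaGroupSchemeII, §2 (p. 1168: L a graded left k[F]-module, F the p-th power map)] -/
theorem addForm_frobVec_one (e : ℕ) (a : Fin (n + 1) → k) :
    addForm k p (e + 1) (frobVec k p 1 a) = addForm k p e a ^ p := by
  simp only [addForm, frobVec, pow_one]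
  rw [sum_pow_char]
  refine Finset.sum_congr rfl fun j _ => ?_
  rw [mul_pow, ← C_pow, ← pow_mul, pow_succ]

/-- **Hironaka's `U(𝔭) ∩ L_e` on coefficient vectors.**  Hironaka (Ann. of Math. 92 (1970)) and Mizutani
(Def. 1.1) attach to a point `𝔭` of `ℙ^n_k` the graded algebra `U(𝔭) = Σ_m U_m(𝔭)`,
`U_m(𝔭) = {f ∈ S_m : mult_𝔭(Proj(S/fS)) ≥ m}`, and the subgroup scheme `B(𝔭) = Spec(S/U_+(𝔭)S)`; Mizutani
§1 (c) defines the exponent of `B(𝔭)` to be the exponent of the graded `k[F]`-module `U(𝔭) ∩ L`.  Since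
`ℙ^n` is smooth, "`mult_𝔭 f ≥ m`" is transcribed as membership of `f` in the `m`-th symbolic power
`𝔭^{(m)} = 𝔭^m S_𝔭 ∩ S` (`s f ∈ 𝔭^m` for some `s ∉ 𝔭`).  `hirForms k p 𝔭 e` is the `k`-subspace of
coefficient vectors `a` whose additive form `Σ a_j X_j^{p^e}` lies in `𝔭^{(p^e)}`, i.e. `U(𝔭) ∩ L_e`.
[cite: Mizutani1973HironakaGroupSchemes, §1 (Def. 1.1: U_m(𝔭), B_{ℙ^n,𝔭} = Spec(S/U_+(𝔭)S); (c): "We define the exponent of B_{ℙ^n,𝔭} to be e(U(𝔭) ∩ L)")] -/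
noncomputable def hirForms (𝔭 : Ideal (MvPolynomial (Fin (n + 1)) k)) [h𝔭 : 𝔭.IsPrime] (e : ℕ) :
    Submodule k (Fin (n + 1) → k) where
  carrier := {a | ∃ s ∉ 𝔭, s * addForm k p e a ∈ 𝔭 ^ p ^ e}
  zero_mem' := ⟨1, (Ideal.ne_top_iff_one 𝔭).mp h𝔭.ne_top, by
    have : addForm k p e (0 : Fin (n + 1) → k) = 0 := by simp [addForm]
    rw [this, mul_zero]; exact Ideal.zero_mem _⟩
  add_mem' := by
    rintro a b ⟨s, hs, hsa⟩ ⟨t, ht, htb⟩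
    refine ⟨s * t, fun h => (h𝔭.mem_or_mem h).elim hs ht, ?_⟩
    -- additivity of `addForm` (also `…Directrix214SharpCore.addForm_add` in the res-hironaka cell)
    have hadd : addForm k p e (a + b) = addForm k p e a + addForm k p e b := by
      simp only [addForm, Pi.add_apply, map_add, add_mul, Finset.sum_add_distrib]
    rw [hadd, mul_add]
    refine Ideal.add_mem _ ?_ ?_
    · rw [mul_comm s t, mul_assoc]; exact Ideal.mul_mem_left _ _ hsa
    · rw [mul_assoc]; exact Ideal.mul_mem_left _ _ htb
  smul_mem' := by
    rintro c a ⟨s, hs, hsa⟩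
    refine ⟨s, hs, ?_⟩
    rw [addForm_smul, mul_left_comm]
    exact Ideal.mul_mem_left _ _ hsa

variable {k p}

omit [Fact p.Prime] [CharP k p] in
/-- Membership in `hirForms`. [cite: Mizutani1973HironakaGroupSchemes, §1 Def. 1.1 and (c)] -/
theorem mem_hirForms_iff {𝔭 : Ideal (MvPolynomial (Fin (n + 1)) k)} [𝔭.IsPrime] {e : ℕ}
    {a : Fin (n + 1) → k} : a ∈ hirForms k p 𝔭 e ↔ ∃ s ∉ 𝔭, s * addForm k p e a ∈ 𝔭 ^ p ^ e :=
  Iff.rfl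

/-- **`U(𝔭) ∩ L_e ⊆ (L_B)_e`**: an additive form of degree `p^e` with multiplicity `≥ p^e` at the prime `𝔭`
(i.e. in `𝔭^{(p^e)}`) is an invariant additive form in Oda's sense — for every coefficient differential
operator `D` of order `≤ p^e − 1` over `k^{p^e}`, `Σ D(a_j) X_j^{p^e} ∈ 𝔭`.  Holds for EVERY prime `𝔭`.
The converse is Oda 1973 Prop. 2.2 (ii) (quoted in Oda 1983-II, p. 1168) and is not proved in this file.
[cite: Oda1983HironakaGroupSchemeII, §2 (p. 1168: "[O_1, Proposition 2.2, (ii)] then showed that (L_B(𝔭))_e = {h ∈ L_e ; Dh ∈ 𝔭 ∩ L_e for all D ∈ Diff_{p^e−1}(k/F^e(k))}")] -/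
theorem mem_invForms_of_mul_mem_pow {𝔭 : Ideal (MvPolynomial (Fin (n + 1)) k)} (h𝔭 : 𝔭.IsPrime)
    {e : ℕ} {a : Fin (n + 1) → k} (ha : ∃ s ∉ 𝔭, s * addForm k p e a ∈ 𝔭 ^ p ^ e) :
    a ∈ invForms k p 𝔭 e := by
  intro D hD
  rw [← coeffOp_addForm]
  exact coeffOp_mem_of_mul_mem_pow e h𝔭 hD ha

/-- **`U(𝔭) ∩ L_e ⊆ (L_B)_e`** as an inclusion of `k`-subspaces of coefficient vectors.
[cite: Oda1983HironakaGroupSchemeII, §2 (p. 1168); Mizutani1973HironakaGroupSchemes, §1 (c)] -/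
theorem hirForms_le_invForms (𝔭 : Ideal (MvPolynomial (Fin (n + 1)) k)) [h𝔭 : 𝔭.IsPrime] (e : ℕ) :
    hirForms k p 𝔭 e ≤ invForms k p 𝔭 e :=
  fun _ ha => mem_invForms_of_mul_mem_pow h𝔭 ha

/-- `U(𝔭) ∩ L` is `F`-stable: `a ∈ U(𝔭) ∩ L_e ⇒ F a ∈ U(𝔭) ∩ L_{e+1}` (`(s h)^p ∈ 𝔭^{p·p^e}`), so it is a
graded `k[F]`-submodule of `L` as Mizutani's definition (c) requires.
[cite: Mizutani1973HironakaGroupSchemes, §1 (a), (c) (L a graded left k[F]-module; e(U(𝔭) ∩ L))] -/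
theorem frobVec_one_mem_hirForms {𝔭 : Ideal (MvPolynomial (Fin (n + 1)) k)} [h𝔭 : 𝔭.IsPrime] {e : ℕ}
    {a : Fin (n + 1) → k} (ha : a ∈ hirForms k p 𝔭 e) : frobVec k p 1 a ∈ hirForms k p 𝔭 (e + 1) := by
  obtain ⟨s, hs, hsa⟩ := ha
  refine ⟨s ^ p, fun h => hs (h𝔭.mem_of_pow_mem _ h), ?_⟩
  rw [addForm_frobVec_one, ← mul_pow, pow_succ, pow_mul]
  exact Ideal.pow_mem_pow hsa p

omit [Fact p.Prime] [CharP k p] in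
/-- At level `0` the symbolic power is `𝔭` itself: `U(𝔭) ∩ L_0 = {a : Σ a_j X_j ∈ 𝔭}`.
[cite: Mizutani1973HironakaGroupSchemes, §1 Def. 1.1 (U_1(𝔭))] -/
theorem mem_hirForms_zero_iff {𝔭 : Ideal (MvPolynomial (Fin (n + 1)) k)} [h𝔭 : 𝔭.IsPrime]
    {a : Fin (n + 1) → k} : a ∈ hirForms k p 𝔭 0 ↔ addForm k p 0 a ∈ 𝔭 := by
  rw [mem_hirForms_iff, pow_zero, pow_one]
  constructor
  · rintro ⟨s, hs, hsa⟩
    exact (h𝔭.mem_or_mem hsa).resolve_left hs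
  · intro ha
    exact ⟨1, (Ideal.ne_top_iff_one 𝔭).mp h𝔭.ne_top, by rw [one_mul]; exact ha⟩

/-- At level `0` Oda's condition is also just `Σ a_j X_j ∈ 𝔭` (the operators of order `≤ 0` over
`k^{p^0} = k` are the multiplications). [cite: Oda1983HironakaGroupSchemeII, §2 (p. 1168)] -/
theorem mem_invForms_zero_iff {𝔭 : Ideal (MvPolynomial (Fin (n + 1)) k)}
    {a : Fin (n + 1) → k} : a ∈ invForms k p 𝔭 0 ↔ addForm k p 0 a ∈ 𝔭 := by
  constructor
  · intro ha
    have h := ha LinearMap.id (isDiffOpLE_id (R := frobPow k p 0) (A := k))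
    simpa using h
  · intro ha D hD
    -- an operator of order `≤ 0` is the multiplication by `D 1`
    have hD1 : D = LinearMap.mulLeft (frobPow k p 0) (D 1) := isDiffOpLE_zero_iff_eq_mulLeft.mp hD
    have : (fun j => D (a j)) = D 1 • a := by
      funext j; rw [hD1]; simp [LinearMap.mulLeft_apply]
    rw [show p ^ 0 - 1 = 0 from rfl] at hD
    rw [this, addForm_smul]
    exact Ideal.mul_mem_left _ _ ha

/-- **Level `0`: `U(𝔭) ∩ L_0 = (L_B)_0`.** [cite: Oda1983HironakaGroupSchemeII, §2 (p. 1168); Mizutani1973HironakaGroupSchemes, §1 Def. 1.1] -/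
theorem hirForms_zero (𝔭 : Ideal (MvPolynomial (Fin (n + 1)) k)) [𝔭.IsPrime] :
    hirForms k p 𝔭 0 = invForms k p 𝔭 0 := by
  ext a
  rw [mem_hirForms_zero_iff, mem_invForms_zero_iff]

end HirForms

end Summit.ResolutionOfSingularities.KangarooAtlas.Mizutani
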